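import Summits.QuantumFields.YangMills.Theorems.LuscherReductionTwistedTraceScalingGaugeActionLinear
import Summits.QuantumFields.YangMills.Theorems.LuscherReductionTwistedTraceScalingOrthoTubeCoverage
import Summits.QuantumFields.YangMills.Theorems.LuscherReductionTwistedTraceScalingQuaternionStep
import HarnessLib

/-!
# LINEARISATION OF THE TRANSVERSE COORDINATE under a near-identity gauge transformation: for `W_e = P(w_e)` (w balanced, small) and `h_x = P(ξ_x)`,
# `relLinkVec(W^h)_e = w_e + ξ_x − ξ_y + R_e`, `‖R_e‖∞ ≤ 440(G² + G ω)` — the polar mean moves only at SECOND order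
# (the core algebraic lemma of the Faddeev–Popov weight asymptotics (N1)/(N2); lane A of S-BASE, crux `TwistedTraceScaling` stmt-QuantumFields-20203, C4 INNER;
# design note `pub/ym-fleet/ym-luscher-20007-p1/COARSE-DESIGN.md` §23.6 (C))

With `G ≥ max_x ‖ξ_x‖∞`, `ω ≥ max_e ‖w_e‖∞`, `G, ω ≤ 1/20`, and `w` balanced (`Σ_x w_{(x,k)} = 0`):
* `scalarPart_conj_chart` (exact) and `scalarPart_conj_chart_ge_half`: the transformed links stay in the cap, `(h_x W_e h_y⁻¹)₀ ≥ 1/2`;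
* ★ `norm_dirVecSum_gaugeTransform_le`: the vector sum of a direction is SECOND order, `‖Σ_x (h W h⁻¹)⃗_{(x,k)}‖∞ ≤ N·40(G² + Gω)` — the linear terms cancel:
  `Σ_x w_{(x,k)} = 0` (balance) and `Σ_x (ξ_x − ξ_{x+k}) = 0` (telescoping on the torus, `sum_shift_eq`);
* hence the polar mean `p_k(W^h)` has `‖p⃗_k‖∞ ≤ 2ρ`, `0 ≤ 1 − (p_k)₀ ≤ 4ρ` (`ρ = 40(G² + Gω)`; `polarMean_parts_small`);
* ★★ `norm_relLink_gaugeTransform_sub_linear_le`: `‖((W^h)_e · p_{dir e}(W^h)⁻¹)⃗ − (w_e + ξ_x − ξ_y)‖∞ ≤ 440·(G² + G ω)` for every link `e = (x → y)`.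
So the first-order action of the gauge group on the transverse coordinate of the orthographic tube (at the vacuum slow point; general `u` by `orthoTube_mul` +
conjugation) is `ξ ↦ −vacGrad ξ`, with an explicit quadratic remainder carrying a gauge factor — the input of the minimiser argument (N1) (interior critical point
⇒ `P_Γ v = 0`) and of the Laplace step (N2) for `N = gaugeAvg χ`.
HONEST FRAMING: elementary quaternion algebra for a stub of a child of the CONDITIONAL reduction route R2b1; no kernel estimate; C4 OPEN; not a gap, not Clay.
-/

set_option autoImplicit false

noncomputable section

open Real
open scoped BigOperators Matrix
open Literature.MathematicalPhysics.QuantumFieldTheory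
open Literature.MathematicalPhysics.QuantumLattice

namespace Summit.QuantumFields.YangMills.Theorems.FemtoTransferGap.TwoLattice.ConstTube

open Summit.QuantumFields.YangMills.Theorems.FemtoTransferGap
open Summit.QuantumFields.YangMills.Theorems.FemtoTransferGap.TwoLattice.Cov (scalarPart_inv vecPart_inv abs_vecPart_le_one)
open Literature.Algebra.EuclideanLattices (abs_apply_le_norm)

variable (L : ℕ) [NeZero L]

/-! ## §1 The scalar part of a transformed link stays in the cap -/

/-- ★ **Exact scalar part of `P(ξ)·P(w)·P(ζ)⁻¹`**: `(am − ξ·w)b + (a w + m ξ + ξ×w)·ζ`. [cite: BrockerTomDieck1985, I (1.10)] -/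
theorem scalarPart_conj_chart {ξ w ζ : Fin 3 → ℝ} (hξ : ∑ a, ξ a ^ 2 ≤ 1) (hw : ∑ a, w a ^ 2 ≤ 1) (hζ : ∑ a, ζ a ^ 2 ≤ 1) :
    scalarPart (chartSU2 ξ * chartSU2 w * (chartSU2 ζ)⁻¹) =
      (√(1 - ∑ a, ξ a ^ 2) * √(1 - ∑ a, w a ^ 2) - ξ ⬝ᵥ w) * √(1 - ∑ a, ζ a ^ 2) +
        (√(1 - ∑ a, ξ a ^ 2) • w + √(1 - ∑ a, w a ^ 2) • ξ + ξ ⨯₃ w) ⬝ᵥ ζ := by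
  rw [scalarPart_mul, scalarPart_inv, vecPart_inv, scalarPart_mul, vecPart_mul, scalarPart_chartSU2 hξ, scalarPart_chartSU2 hw, scalarPart_chartSU2 hζ,
    vecPart_chartSU2 hξ, vecPart_chartSU2 hw, vecPart_chartSU2 hζ, dotProduct_neg, sub_neg_eq_add]

omit [NeZero L] in
/-- The transformed link stays in the cap: `(P(ξ)P(w)P(ζ)⁻¹)₀ ≥ 1/2` for sup-norms `≤ 1/20`. [folklore] -/
theorem scalarPart_conj_chart_ge_half {ξ w ζ : Fin 3 → ℝ} (hξ : ‖ξ‖ ≤ 1 / 20) (hw : ‖w‖ ≤ 1 / 20) (hζ : ‖ζ‖ ≤ 1 / 20) :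
    1 / 2 ≤ scalarPart (chartSU2 ξ * chartSU2 w * (chartSU2 ζ)⁻¹) := by
  obtain ⟨ha0, ha, ha1⟩ := one_sub_sqrt_le (v := ξ) (by linarith)
  obtain ⟨hm0, hm, hm1⟩ := one_sub_sqrt_le (v := w) (by linarith)
  obtain ⟨hb0, hb, hb1⟩ := one_sub_sqrt_le (v := ζ) (by linarith)
  have hξ1 : ∑ i, ξ i ^ 2 ≤ 1 := by nlinarith [sum_sq_le_three_norm_sq ξ, norm_nonneg ξ]
  have hw1 : ∑ i, w i ^ 2 ≤ 1 := by nlinarith [sum_sq_le_three_norm_sq w, norm_nonneg w]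
  have hζ1 : ∑ i, ζ i ^ 2 ≤ 1 := by nlinarith [sum_sq_le_three_norm_sq ζ, norm_nonneg ζ]
  rw [scalarPart_conj_chart hξ1 hw1 hζ1]
  set a := √(1 - ∑ i, ξ i ^ 2)
  set m := √(1 - ∑ i, w i ^ 2)
  set b := √(1 - ∑ i, ζ i ^ 2)
  have hξ0 := norm_nonneg ξ
  have hw0 := norm_nonneg w
  have hζ0 := norm_nonneg ζ
  -- `a, m, b ≥ 1 − 3/400`
  have ha' : 1 - 3 * (1 / 20) ^ 2 ≤ a := by nlinarith
  have hm' : 1 - 3 * (1 / 20) ^ 2 ≤ m := by nlinarith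
  have hb' : 1 - 3 * (1 / 20) ^ 2 ≤ b := by nlinarith
  have hdot : |ξ ⬝ᵥ w| ≤ 3 * (‖ξ‖ * ‖w‖) := abs_dotProduct_le_three ξ w
  have hdot' : |ξ ⬝ᵥ w| ≤ 3 * ((1 / 20) * (1 / 20)) := hdot.trans (by nlinarith)
  set v1 := a • w + m • ξ + ξ ⨯₃ w with hv1
  have hv1n : ‖v1‖ ≤ ‖w‖ + ‖ξ‖ + 2 * (‖ξ‖ * ‖w‖) := by
    rw [hv1]
    calc ‖a • w + m • ξ + ξ ⨯₃ w‖ ≤ ‖a • w‖ + ‖m • ξ‖ + ‖ξ ⨯₃ w‖ := norm_add₃_le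
      _ ≤ ‖w‖ + ‖ξ‖ + 2 * (‖ξ‖ * ‖w‖) := by
          rw [norm_smul_real, norm_smul_real, abs_of_nonneg (Real.sqrt_nonneg _), abs_of_nonneg (Real.sqrt_nonneg _)]
          have h1 : a * ‖w‖ ≤ ‖w‖ := by nlinarith
          have h2 : m * ‖ξ‖ ≤ ‖ξ‖ := by nlinarith
          linarith [norm_cross_le_two ξ w]
  have hv1ζ : |v1 ⬝ᵥ ζ| ≤ 3 * (‖v1‖ * ‖ζ‖) := abs_dotProduct_le_three v1 ζ
  have hv1n' : ‖v1‖ ≤ 1 / 20 + 1 / 20 + 2 * ((1 / 20) * (1 / 20)) := hv1n.trans (by nlinarith)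
  have hv1ζ' : |v1 ⬝ᵥ ζ| ≤ 3 * ((1 / 20 + 1 / 20 + 2 * ((1 / 20) * (1 / 20))) * (1 / 20)) :=
    hv1ζ.trans (by nlinarith [norm_nonneg v1])
  have h1 := (abs_le.mp hdot').2
  have h2 := (abs_le.mp hv1ζ').1
  -- `(am − ξ·w) b + v1·ζ ≥ (0.9925² − 0.0075)·0.9925 − 0.01575 ≥ 1/2`
  have ham : (1 - 3 * (1 / 20) ^ 2) * (1 - 3 * (1 / 20) ^ 2) ≤ a * m := by nlinarith
  nlinarith

/-! ## §2 The direction sums of the transformed configuration: the linear terms cancel -/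

omit [NeZero L] in
/-- Telescoping on the torus: `Σ_x ξ_{x + e_k} = Σ_x ξ_x`. [folklore] -/
theorem sum_shift_eq {M : Type*} [AddCommMonoid M] [NeZero L] (ξ : Site 3 L → M) (k : Fin 3) :
    ∑ x : Site 3 L, ξ (x.shift k) = ∑ x : Site 3 L, ξ x := by
  simp only [Site.shift]
  exact Fintype.sum_equiv (Equiv.addRight (Pi.single k (1 : ZMod L))) _ _ fun x => rfl

omit [NeZero L] in
/-- The configuration `W_e = P(w_e)` is the orthographic tube point `orthoTube L 1 w`. [folklore] -/
theorem orthoTube_one (w : Edge 3 L → Fin 3 → ℝ) : orthoTube L 1 w = fun e => chartSU2 (w e) := by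
  funext e; simp [orthoTube]

omit [NeZero L] in
/-- Links of the gauge transform of `W_e = P(w_e)` by `h_x = P(ξ_x)`. [folklore] -/
theorem gaugeTransform_chart_apply (ξ : Site 3 L → Fin 3 → ℝ) (w : Edge 3 L → Fin 3 → ℝ) (e : Edge 3 L) :
    gaugeTransform (fun x => chartSU2 (ξ x)) (fun e => chartSU2 (w e)) e = chartSU2 (ξ e.1) * chartSU2 (w e) * (chartSU2 (ξ (e.1.shift e.2)))⁻¹ := by
  simp [gaugeTransform]

section Main

variable {L}
variable {ξ : Site 3 L → Fin 3 → ℝ} {w : Edge 3 L → Fin 3 → ℝ} {G ω : ℝ}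
  (hG : ∀ x, ‖ξ x‖ ≤ G) (hω : ∀ e, ‖w e‖ ≤ ω) (hG1 : G ≤ 1 / 20) (hω1 : ω ≤ 1 / 20)

include hG hω hG1 hω1

omit [NeZero L] in
/-- Per link: `‖(h_x W_e h_y⁻¹)⃗ − (w_e + ξ_x − ξ_y)‖∞ ≤ 40(G² + Gω)`. [folklore] -/
theorem norm_vecPart_gaugeTransform_sub_linear_le (e : Edge 3 L) :
    ‖vecPart (gaugeTransform (fun x => chartSU2 (ξ x)) (fun e => chartSU2 (w e)) e) - (w e + ξ e.1 - ξ (e.1.shift e.2))‖ ≤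
      40 * (G ^ 2 + G * ω) := by
  have hG0 : 0 ≤ G := (norm_nonneg _).trans (hG e.1)
  rw [gaugeTransform_chart_apply]
  have h := norm_vecPart_conj_chart_sub_linear_le (ξ := ξ e.1) (w := w e) (ζ := ξ (e.1.shift e.2))
    ((hG _).trans (by linarith)) ((hω _).trans (by linarith)) ((hG _).trans (by linarith))
  refine h.trans (mul_le_mul_of_nonneg_left ?_ (by norm_num))
  have hmax : max ‖ξ e.1‖ ‖ξ (e.1.shift e.2)‖ ≤ G := max_le (hG _) (hG _)
  have hmax0 : 0 ≤ max ‖ξ e.1‖ ‖ξ (e.1.shift e.2)‖ := le_max_of_le_left (norm_nonneg _)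
  have h1 : max ‖ξ e.1‖ ‖ξ (e.1.shift e.2)‖ ^ 2 ≤ G ^ 2 := pow_le_pow_left₀ hmax0 hmax 2
  have h2 : max ‖ξ e.1‖ ‖ξ (e.1.shift e.2)‖ * ‖w e‖ ≤ G * ω := mul_le_mul hmax (hω e) (norm_nonneg _) hG0
  linarith

omit [NeZero L] in
/-- Every transformed link stays in the cap: scalar part `≥ 1/2`. [folklore] -/
theorem half_le_scalarPart_gaugeTransform (e : Edge 3 L) :
    1 / 2 ≤ scalarPart (gaugeTransform (fun x => chartSU2 (ξ x)) (fun e => chartSU2 (w e)) e) := by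
  rw [gaugeTransform_chart_apply]
  exact scalarPart_conj_chart_ge_half ((hG _).trans hG1) ((hω _).trans hω1) ((hG _).trans hG1)

/-- ★ **The vector sum of a direction is second order**: `‖Σ_x (W^h)⃗_{(x,k)}‖∞ ≤ N·40(G² + Gω)` for balanced `w` (telescoping + balance kill the linear terms).
[folklore] -/
theorem norm_dirVecSum_gaugeTransform_le (hbal : ∀ (k : Fin 3) (a : Fin 3), ∑ x : Site 3 L, w (x, k) a = 0) (k : Fin 3) :
    ‖dirVecSum L k (gaugeTransform (fun x => chartSU2 (ξ x)) (fun e => chartSU2 (w e)))‖ ≤ Fintype.card (Site 3 L) * (40 * (G ^ 2 + G * ω)) := by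
  set U := gaugeTransform (fun x => chartSU2 (ξ x)) (fun e => chartSU2 (w e)) with hU
  -- the linear part sums to zero
  have hw0 : ∑ x : Site 3 L, w (x, k) = 0 := by
    funext a; rw [Finset.sum_apply, Pi.zero_apply]; exact hbal k a
  have hlin : ∑ x : Site 3 L, (w (x, k) + ξ x - ξ (x.shift k)) = 0 := by
    rw [Finset.sum_sub_distrib, Finset.sum_add_distrib, sum_shift_eq L ξ k, hw0, zero_add, sub_self]
  have hsplit : dirVecSum L k U = ∑ x : Site 3 L, (vecPart (U (x, k)) - (w (x, k) + ξ x - ξ (x.shift k))) := by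
    rw [Finset.sum_sub_distrib, hlin, sub_zero]; rfl
  rw [hsplit]
  calc ‖∑ x : Site 3 L, (vecPart (U (x, k)) - (w (x, k) + ξ x - ξ (x.shift k)))‖
      ≤ ∑ x : Site 3 L, ‖vecPart (U (x, k)) - (w (x, k) + ξ x - ξ (x.shift k))‖ := norm_sum_le _ _
    _ ≤ ∑ _x : Site 3 L, 40 * (G ^ 2 + G * ω) := Finset.sum_le_sum fun x _ => by
        have h := norm_vecPart_gaugeTransform_sub_linear_le hG hω hG1 hω1 (x, k)
        exact h
    _ = Fintype.card (Site 3 L) * (40 * (G ^ 2 + G * ω)) := by rw [Finset.sum_const, Finset.card_univ, nsmul_eq_mul]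

/-- The scalar sum of a direction is at least `N/2`. [folklore] -/
theorem dirScalarSum_gaugeTransform_ge (k : Fin 3) :
    (Fintype.card (Site 3 L) : ℝ) / 2 ≤ dirScalarSum L k (gaugeTransform (fun x => chartSU2 (ξ x)) (fun e => chartSU2 (w e))) := by
  unfold dirScalarSum
  calc (Fintype.card (Site 3 L) : ℝ) / 2 = ∑ _x : Site 3 L, (1 / 2 : ℝ) := by
        rw [Finset.sum_const, Finset.card_univ, nsmul_eq_mul]; ring
    _ ≤ _ := Finset.sum_le_sum fun x _ => half_le_scalarPart_gaugeTransform hG hω hG1 hω1 (x, k)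

/-- ★ **The polar mean moves only at second order**: `‖p⃗_k‖∞ ≤ 2ρ`, `0 ≤ 1 − (p_k)₀ ≤ 4ρ`, `ρ = 40(G² + Gω)`. [folklore] -/
theorem polarMean_parts_small (hbal : ∀ (k : Fin 3) (a : Fin 3), ∑ x : Site 3 L, w (x, k) a = 0) (k : Fin 3) :
    ‖vecPart (polarMean L k (gaugeTransform (fun x => chartSU2 (ξ x)) (fun e => chartSU2 (w e))))‖ ≤ 2 * (40 * (G ^ 2 + G * ω)) ∧
      0 ≤ 1 - scalarPart (polarMean L k (gaugeTransform (fun x => chartSU2 (ξ x)) (fun e => chartSU2 (w e)))) ∧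
      1 - scalarPart (polarMean L k (gaugeTransform (fun x => chartSU2 (ξ x)) (fun e => chartSU2 (w e)))) ≤ 4 * (40 * (G ^ 2 + G * ω)) := by
  set U := gaugeTransform (fun x => chartSU2 (ξ x)) (fun e => chartSU2 (w e)) with hU
  set ρ := 40 * (G ^ 2 + G * ω) with hρ
  set N : ℝ := (Fintype.card (Site 3 L) : ℝ) with hN
  have hNpos : 0 < N := by rw [hN]; exact_mod_cast Fintype.card_pos
  have hS := dirScalarSum_gaugeTransform_ge hG hω hG1 hω1 k
  have hSpos : 0 < dirScalarSum L k U := by rw [hU]; linarith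
  have hM0 : dirQuat L k U ≠ 0 := dirQuat_ne_zero_of_scalarSum_pos L hSpos
  obtain ⟨hs, hv⟩ := parts_polarMean L hM0
  have hV := norm_dirVecSum_gaugeTransform_le hG hω hG1 hω1 hbal k
  rw [← hU] at hV
  have hG0 : 0 ≤ G := (norm_nonneg _).trans (hG 0)
  have hω0 : 0 ≤ ω := (norm_nonneg _).trans (hω ((0 : Site 3 L), k))
  have hρ0 : 0 ≤ ρ := by rw [hρ]; positivity
  -- `S ≤ ‖M‖ ≤ S + 2‖V‖`
  set S := dirScalarSum L k U with hSdef
  set V := dirVecSum L k U with hVdef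
  have hMnorm : ‖dirQuat L k U‖ = √(S ^ 2 + ∑ a, V a ^ 2) := norm_dirQuat L k U
  have hV2 : ∑ a, V a ^ 2 ≤ 3 * ‖V‖ ^ 2 := sum_sq_le_three_norm_sq V
  have hV0 : 0 ≤ ‖V‖ := norm_nonneg V
  have hMge : S ≤ ‖dirQuat L k U‖ := by
    rw [hMnorm]
    calc S = √(S ^ 2) := (Real.sqrt_sq hSpos.le).symm
      _ ≤ √(S ^ 2 + ∑ a, V a ^ 2) := Real.sqrt_le_sqrt (le_add_of_nonneg_right (Finset.sum_nonneg fun a _ => sq_nonneg _))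
  have hMle : ‖dirQuat L k U‖ ≤ S + 2 * ‖V‖ := by
    rw [hMnorm]
    calc √(S ^ 2 + ∑ a, V a ^ 2) ≤ √((S + 2 * ‖V‖) ^ 2) := Real.sqrt_le_sqrt (by nlinarith)
      _ = S + 2 * ‖V‖ := Real.sqrt_sq (by linarith)
  have hMpos : 0 < ‖dirQuat L k U‖ := hSpos.trans_le hMge
  have hVS : ‖V‖ ≤ N * ρ := hV
  have hS2 : N / 2 ≤ S := hS
  refine ⟨?_, ?_, ?_⟩
  · -- `‖p⃗‖ = ‖V‖/‖M‖ ≤ Nρ/(N/2) = 2ρ`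
    rw [hv, norm_smul_real, abs_of_pos (inv_pos.mpr hMpos)]
    rw [inv_mul_le_iff₀ hMpos]
    calc ‖V‖ ≤ N * ρ := hVS
      _ ≤ S * (2 * ρ) := by nlinarith
      _ ≤ ‖dirQuat L k U‖ * (2 * ρ) := mul_le_mul_of_nonneg_right hMge (by positivity)
  · rw [hs, sub_nonneg, inv_mul_le_iff₀ hMpos, mul_one]; exact hMge
  · -- `1 − S/‖M‖ ≤ 2‖V‖/‖M‖ ≤ 2‖V‖/S ≤ 4ρ`
    rw [hs]
    have h1 : 1 - ‖dirQuat L k U‖⁻¹ * S = (‖dirQuat L k U‖ - S) / ‖dirQuat L k U‖ := by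
      field_simp
    rw [h1, div_le_iff₀ hMpos]
    calc ‖dirQuat L k U‖ - S ≤ 2 * ‖V‖ := by linarith
      _ ≤ 2 * (N * ρ) := by linarith
      _ ≤ 4 * ρ * S := by nlinarith
      _ ≤ 4 * ρ * ‖dirQuat L k U‖ := mul_le_mul_of_nonneg_left hMge (by positivity)

omit hG hω hG1 hω1 in
/-- The vector part of a unit quaternion has sup norm `≤ 1`. [folklore] -/
theorem norm_vecPart_le_one (A : SU2) : ‖vecPart A‖ ≤ 1 :=
  (pi_norm_le_iff_of_nonneg zero_le_one).mpr fun a => by rw [Real.norm_eq_abs]; exact abs_vecPart_le_one A a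

/-- ★★ **LINEARISATION OF THE TRANSVERSE COORDINATE UNDER THE GAUGE ACTION**: for `W_e = P(w_e)` (`w` balanced, `‖w_e‖∞ ≤ ω ≤ 1/20`) and `h_x = P(ξ_x)`
(`‖ξ_x‖∞ ≤ G ≤ 1/20`): `‖((W^h)_e · p_{dir e}(W^h)⁻¹)⃗ − (w_e + ξ_x − ξ_y)‖∞ ≤ 440·(G² + Gω)`. [folklore] -/
theorem norm_relLink_gaugeTransform_sub_linear_le (hbal : ∀ (k : Fin 3) (a : Fin 3), ∑ x : Site 3 L, w (x, k) a = 0) (e : Edge 3 L) :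
    ‖vecPart (gaugeTransform (fun x => chartSU2 (ξ x)) (fun e => chartSU2 (w e)) e *
          (polarMean L e.2 (gaugeTransform (fun x => chartSU2 (ξ x)) (fun e => chartSU2 (w e))))⁻¹) -
        (w e + ξ e.1 - ξ (e.1.shift e.2))‖ ≤ 440 * (G ^ 2 + G * ω) := by
  set U := gaugeTransform (fun x => chartSU2 (ξ x)) (fun e => chartSU2 (w e)) with hU
  set ρ := 40 * (G ^ 2 + G * ω) with hρ
  set p := polarMean L e.2 U with hp
  set lin := w e + ξ e.1 - ξ (e.1.shift e.2) with hlin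
  obtain ⟨hvp, hsp0, hsp⟩ := polarMean_parts_small hG hω hG1 hω1 hbal e.2
  rw [← hU, ← hp] at hvp hsp0 hsp
  have h1 : ‖vecPart (U e) - lin‖ ≤ ρ := norm_vecPart_gaugeTransform_sub_linear_le hG hω hG1 hω1 e
  have hve : ‖vecPart (U e)‖ ≤ 1 := norm_vecPart_le_one (U e)
  have hse : |scalarPart (U e)| ≤ 1 := abs_scalarPart_le (U e)
  have hG0 : 0 ≤ G := (norm_nonneg _).trans (hG e.1)
  have hω0 : 0 ≤ ω := (norm_nonneg _).trans (hω e)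
  have hρ0 : 0 ≤ ρ := by rw [hρ]; positivity
  -- decomposition of the relative link
  have hdec : vecPart (U e * p⁻¹) - lin =
      (vecPart (U e) - lin) + (scalarPart p - 1) • vecPart (U e) - scalarPart (U e) • vecPart p - vecPart (U e) ⨯₃ vecPart p := by
    rw [vecPart_mul_inv]; module
  rw [hdec]
  have hT2 : ‖(scalarPart p - 1) • vecPart (U e)‖ ≤ 4 * ρ := by
    rw [norm_smul_real, show |scalarPart p - 1| = 1 - scalarPart p by rw [abs_sub_comm]; exact abs_of_nonneg hsp0]
    calc (1 - scalarPart p) * ‖vecPart (U e)‖ ≤ (4 * ρ) * 1 := mul_le_mul hsp hve (norm_nonneg _) (by positivity)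
      _ = 4 * ρ := mul_one _
  have hT3 : ‖scalarPart (U e) • vecPart p‖ ≤ 2 * ρ := by
    rw [norm_smul_real]
    calc |scalarPart (U e)| * ‖vecPart p‖ ≤ 1 * (2 * ρ) := mul_le_mul hse hvp (norm_nonneg _) zero_le_one
      _ = 2 * ρ := one_mul _
  have hT4 : ‖vecPart (U e) ⨯₃ vecPart p‖ ≤ 4 * ρ := by
    calc ‖vecPart (U e) ⨯₃ vecPart p‖ ≤ 2 * (‖vecPart (U e)‖ * ‖vecPart p‖) := norm_cross_le_two _ _
      _ ≤ 2 * (1 * (2 * ρ)) := by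
          have := mul_le_mul hve hvp (norm_nonneg _) zero_le_one
          linarith
      _ = 4 * ρ := by ring
  have e1 := norm_sub_le ((vecPart (U e) - lin) + (scalarPart p - 1) • vecPart (U e) - scalarPart (U e) • vecPart p) (vecPart (U e) ⨯₃ vecPart p)
  have e2 := norm_sub_le ((vecPart (U e) - lin) + (scalarPart p - 1) • vecPart (U e)) (scalarPart (U e) • vecPart p)
  have e3 := norm_add_le (vecPart (U e) - lin) ((scalarPart p - 1) • vecPart (U e))
  have hfin : ‖vecPart (U e) - lin + (scalarPart p - 1) • vecPart (U e) - scalarPart (U e) • vecPart p - vecPart (U e) ⨯₃ vecPart p‖ ≤ 11 * ρ := by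
    linarith only [e1, e2, e3, h1, hT2, hT3, hT4]
  calc _ ≤ 11 * ρ := hfin
    _ = 440 * (G ^ 2 + G * ω) := by rw [hρ]; ring

end Main

end Summit.QuantumFields.YangMills.Theorems.FemtoTransferGap.TwoLattice.ConstTube

end
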